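import Literature.IUT.HodgeTheaters.InitialThetaDataTorsionCuspModelEvalSections
import Literature.IUT.HodgeTheaters.InitialThetaDataTorsionCuspModelPointLaws
import Literature.IUT.HodgeTheaters.PiAvatarBaseKitThetaNFInstances
import HarnessLib

/-!
# [IUTchI] Example 4.4 (i)/(iv) at the SINGLE-POINT model `regeom₄`: the evaluation-section binder OF RECORD
# `EvalSectionBinder (localDataStandIn … v) (decompAt v)` INHABITED — §A1 of `…TorsionCuspModelEvalSections` applied at abc-iut-L5-t4's Θ-NF stand-in
# local datum (NV-L5 row «EVALSECT-NV/A», layer (A2) of abc-iut-L5-lead RULINGS #93 (3) / #95 / #96 (iii); one def + theorems)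

S. Mochizuki, *Inter-universal Teichmüller theory I*, kurims manuscript (May 2020), Example 4.4 (i) p. 106 l. 22–27 «the various
sections `G_v → Π_v = Π^tp_{X̲̲_v}` of the natural surjection `Π_v ↠ G_v` that arise from the evaluation points … each evaluation section has an
associated label `∈ |𝔽_l|`», (iv) p. 107 l. 9–10 «each of these labels can only be well-defined up to multiplication by ±1» ([IUTchI] Ex 4.4 (i)
p.106) [claim: Mochizuki2012, status: disputed] (D-0012 claim key; series status DISPUTED — an NV witness for abc-iut-L5-t3's binder `EvalSectionBinder`
(p456293) at abc-iut-L5-t8's SINGLE-POINT MODEL `regeom₄` (stage C: `InitialThetaDataTorsionCuspModelPoint{,Geometry,Normaliser}.lean`); nothing of the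
series is asserted; no side taken on [IUTchIII] Cor. 3.12).

## WHAT (RULINGS #96 (iii): «THE NV OF RECORD = (A2)@regeom₄ = one application of (A1) at δ := regeom₄.localDataStandIn … LITERALLY, Gv := decompAt v»)

* `augGF_regeom₄` (the `hι` of §A1 at `ι := id`), `decompAt_le` (`G_v̲ ≤ G_K`), `localDataStandIn_H` (the stand-in datum's local group is
  `Π_{X̲→_K} ∩ augGF⁻¹ G_v̲` at EVERY index);
* **`uElt_mem_PiXarrow_regeom₄`** — t8's (β): `⟨(u,1),(σ,1)⟩ ∈ Π_{X̲→_K}(regeom₄)` for `u ∈ I_{ℤ·g}·U`, `σ ∈ G_K`: the coboundary part lies in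
  `Ker(Δ_X̲ ↠ Δ_X̲^{ab} ⊗ 𝔽_l)`, which is `pedOf₃`'s kernel DEFINITIONALLY (`Δ_X̲ = U ⋊ ℤ·g` is untouched by stage C), so abc-iut-L5-t8's
  `embU_mem_modLKer₃_of_mem_cob` applies verbatim; `(σ, 1) ∈ D_{2ε} = G × ⟨igenP_{2ε}⟩`;
* **`evalSectionBinder_localDataStandIn_regeom₄ hA v χ hχ : EvalSectionBinder (regeom₄.localDataStandIn CG₄ hS₄ M′₄ hA hI₄ v) (regeom₄.decompAt v)`** —
  the binder of (C″) `kitCoreThetaStandIn … ES` / the certificate's (K‴) as a TERM, at `CG₄ := cuspGaloisRegeom₄`, `hS₄ := cuspClassesNormaliserStable_regeom₄`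
  (C4 — a TERM: `hS` HOLDS at the single-point model), `M′₄ := unramifiedTorsionMonodromyRegeom₄`; binders left: `hA : regeom₄.geom.pe.ArrowCoveringClaims`
  (stage C C3) and a `ℤ/l`-character `χ_v ≠ 1` of `decompAt v`; **`nonempty_evalSectionBinder_localDataStandIn_regeom₄`** (∃-headline);
* **`nonempty_evalSectionBinder_regeom₄ (hA)`** — over `Gv := G_K` with the CYCLOTOMIC character of p465974, NO character hypothesis: the TYPE
  `EvalSectionBinder δ G_K` inhabited at the good-place datum of `regeom₄` (sibling of the stand-in datum; does not feed (C″));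
* `hA` DISCHARGED by abc-iut-L5-t8's stage C C3 `arrowCoveringClaimsRegeom₄` (p473323): **`evalSectionBinderRegeom₄ v χ hχ`** (the ES TERM OF RECORD, modulo
  `χ_v` ONLY), **`nonempty_evalSectionBinderRegeom₄`**, and the BINDER-FREE **`nonempty_evalSectionBinder_regeom₄_GK`**.

(α) (RULINGS #96): `regeom₄.decompAt v` = `D₀.decompAt v` — re-geometrisation keeps the arithmetic of `D₀` — = the GENUINE decomposition group of `K` at the
place under `v` (`decompositionSubgroupGF`, `⊥` at archimedean indices).  The cyclotomic `ℤ/l`-character of `G_K` restricts NON-trivially to it iff the place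
does not split in the degree-`l` layer of `K(ζ_{l^∞})/K`; a place-by-place character exists classically (local class field theory / Grunwald–Wang) but is not
constructed here — hence the HYPOTHESIS `χ_v`, `hχ` (RULINGS #91 (1) (n1): «not claimed for every v»).

HONEST TAGS: «NV at regeom₄ of the EvalSectionBinder OF RECORD, modulo a ℤ/l-character χ_v ≠ 1 of decompAt v ONLY (CG, hS, M′, hL, hA all TERMS of
stage C)»; «NV of the TYPE over G_K at regeom₄: BINDER-FREE».  A model inhabits OUR binders only: nothing about print's evaluation points, theta values or [EtTh] Cor 2.9; typed ≠ inhabited ≠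
discharged; no `Nonempty` conjunct is offered to any certificate before the lead's §E census; no side taken on [IUTchIII] Cor. 3.12.  No instance, no notation.
-/

noncomputable section

namespace Literature.IUT.HodgeTheaters

universe u

/-! ## §A2′ The NV OF RECORD at the single-point datum `regeom₄`: `EvalSectionBinder (localDataStandIn … v) (decompAt v)` -/

section Regeom4

open TorsionCuspModel TorsionMonodromyModel
open scoped Pointwise

variable {F K Fbar : Type u} [Field F] [NumberField F] [Field K] [NumberField K] [Algebra F K] [Field Fbar]
  [Algebra F Fbar] [Algebra K Fbar] {E : WeierstrassCurve F} [E.IsElliptic] {l : ℕ} {Pb : BadPlacePredicates K}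
  [Fact l.Prime]

namespace InitialThetaData

variable (D₀ : InitialThetaData F K Fbar E l Pb)

omit [Fact l.Prime] in
/-- The augmentation of `regeom₄` reads the `G_F`-coordinate. [cite: Mochizuki2012, IUTchI Def 3.1 (b)(c) p.61–62] -/
theorem augGF_regeom₄ (x : TorsionCuspModel.PiC F E Fbar l) : D₀.regeom₄.augGF (x : D₀.regeom₄.PiC) = x.right.1 := rfl

/-- **`H`-MEMBERSHIP at `regeom₄`**: `⟨(u,1),(σ,1)⟩ ∈ Π_{X̲→_K}(regeom₄)` for `u ∈ I_{ℤ·g}·U`, `σ ∈ G_K` — the coboundary part of `U` lies in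
`Ker(Δ_X̲ ↠ Δ_X̲^{ab} ⊗ 𝔽_l)`, which depends on `Δ_X̲ = U ⋊ ℤ·g` only (abc-iut-L5-t8's `embU_mem_modLKer₃_of_mem_cob`, the kernel of `pedOf₄` being that
of `pedOf₃` definitionally), `≤ jKer ≤ Π_{X→} = D_{2ε} ⊔ jKer ∋ (σ, 1)` (`(σ,1) ∈ G × ⟨igenP_{2ε}⟩`). ([IUTchI] Ex 4.4 (i) p.106) [claim: Mochizuki2012, status: disputed] -/
theorem uElt_mem_PiXarrow_regeom₄ {u : U E Fbar l} (hu : u ∈ cob (E := E) D₀.lineGen) {σ : Fbar ≃ₐ[F] Fbar}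
    (hσ : σ ∈ galoisSubgroupOf F K Fbar) : (uElt u σ : D₀.regeom₄.PiC) ∈ D₀.regeom₄.PiXarrow := by
  haveI := D₀.isAlgClosure
  haveI := D₀.isScalarTower
  haveI : CompactSpace (galoisSubgroupOf F K Fbar) :=
    isCompact_iff_compactSpace.mp (ThetaGeometryModel.isClosed_galoisSubgroupOf F K Fbar).isCompact
  have h1 : (uElt u 1 : D₀.regeom₄.PiC) ∈ D₀.regeom₄.PiXarrow := by
    refine ⟨embU (galoisSubgroupOf F K Fbar) u, ?_, ?_⟩
    · have hm := embU_mem_modLKer₃_of_mem_cob (F := F) (galoisSubgroupOf F K Fbar) Quotient.out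
        (D₀.coGen ^ ((l + 1) / 2)) D₀.coGen D₀.l_prime D₀.coGen_not_mem D₀.five_le_l
        (coprime_six_of_prime l D₀.l_prime D₀.five_le_l) hu
      exact Subgroup.mem_sup_right (Subgroup.mem_sup_left (Subgroup.mem_sup_left hm))
    · rfl
  have h2 : (uElt 1 σ : D₀.regeom₄.PiC) ∈ D₀.regeom₄.PiXarrow := by
    refine ⟨(⟨σ, hσ⟩, 1), Subgroup.mem_sup_left (mem_liftU.mpr (one_mem _)), ?_⟩
    show (⟨(1 : DihU F E Fbar l).left, (σ, (1 : DihU F E Fbar l).right)⟩ : TorsionCuspModel.PiC F E Fbar l) = uElt 1 σ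
    rw [uElt, map_one]
    rfl
  have h3 : uElt u σ = uElt u 1 * uElt 1 σ := by
    rw [uElt_mul_uElt fixesTorsion_one, mul_one, one_mul]
  rw [h3]
  exact mul_mem h1 h2

omit [Fact l.Prime] in
/-- The decomposition group at an index lies in `G_K` (at a finite place: abc-iut-L5-t2's `decompositionSubgroupGF_le`; archimedean: `⊥`).
([IUTchI] Def 3.1 (e) p.62) [claim: Mochizuki2012, status: disputed] -/
theorem decompAt_le (D : InitialThetaData F K Fbar E l Pb) (v : D.IndexCopy) : D.decompAt v ≤ galoisSubgroupOf F K Fbar := by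
  haveI := D.isScalarTower
  haveI := D.normal_K
  unfold decompAt
  split
  · exact bot_le
  · exact decompositionSubgroupGF_le F _ _

/-- The local group of abc-iut-L5-t4's Θ-NF stand-in datum at ANY index is `Π_{X̲→_K} ∩ augGF⁻¹ G_v̲` (bad index: the `X̲→`-pair stand-in
`badPairAtArrow`; good index: `LocalDatum.ofGood`). ([IUTchI] Def 3.1 (f) p.63) [claim: Mochizuki2012, status: disputed] -/
theorem localDataStandIn_H {D : InitialThetaData F K Fbar E l Pb} (CG : D.geom.pe.CuspGalois) (hS : D.CuspClassesNormaliserStable)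
    (M : D.TorsionMonodromy) (hA : D.geom.pe.ArrowCoveringClaims)
    (hI : ∀ k ∈ D.geom.pe.inertia D.geom.pe.ε1, M.tau (D.geom.embK k) = 0) (v : D.IndexCopy) :
    (D.localDataStandIn CG hS M hA hI v).H = D.PiXarrow ⊓ (D.decompAt v).comap D.augGF := by
  rw [localDataStandIn, localDataOfBadPairs, localDatumAt_H]
  by_cases h : v ∈ D.indexCopyBad
  · rw [D.localGroupAt_of_mem _ h]
    rfl
  · rw [D.localGroupAt_of_not_mem _ h]

variable (hA₄ : D₀.regeom₄.geom.pe.ArrowCoveringClaims)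

/-- **THE EVALUATION-SECTION BINDER OF RECORD at the single-point datum `regeom₄`** — a TERM of abc-iut-L5-t3's
`EvalSectionBinder (localDataStandIn CG hS M′ hA hI v) (decompAt v)` at EXACTLY abc-iut-L5-t4's Θ-NF stand-in local datum (the `ES` binder consumed by
(C″) `kitCoreThetaStandIn` / the certificate's (K‴)), with `CG := cuspGaloisRegeom₄`, `hS := cuspClassesNormaliserStable_regeom₄` (stage C C4 — a TERM),
`M′ := unramifiedTorsionMonodromyRegeom₄`, MODULO `hA` (stage C C3) and a `ℤ/l`-character `χ_v ≠ 1` of the decomposition group `decompAt v` (at a place `v`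
split in the degree-`l` layer of `K(ζ_{l^∞})/K` the cyclotomic character of p465974 restricts TRIVIALLY — the hypothesis is honest, not dischargeable
for every `v` from the tree).  §A1 applied at `ι := id`, `w_j := cobVec g code(j)`. ([IUTchI] Ex 4.4 (i) p.106) [claim: Mochizuki2012, status: disputed] -/
def evalSectionBinder_localDataStandIn_regeom₄ (v : D₀.regeom₄.IndexCopy)
    (χ : ↥(D₀.regeom₄.decompAt v) →* Multiplicative (ZMod l)) (hχ : χ ≠ 1) :
    EvalSectionBinder
      (D₀.regeom₄.localDataStandIn D₀.cuspGaloisRegeom₄ D₀.cuspClassesNormaliserStable_regeom₄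
        D₀.unramifiedTorsionMonodromyRegeom₄.toTorsionMonodromy hA₄ (D₀.unramifiedTorsionMonodromyRegeom₄.tau_inertia _) v)
      (D₀.regeom₄.decompAt v) :=
  evalSectionBinderOfChar _ (MulEquiv.refl _) D₀.augGF_regeom₄
    (fun σ hσ => D₀.fixesTorsion_of_mem_galoisSubgroupOf σ (D₀.regeom₄.decompAt_le v hσ)) χ
    (fun j => cobVec D₀.lineGen (labelCode j))
    (fun _ k σ => by
      rw [localDataStandIn_H]
      exact ⟨D₀.uElt_mem_PiXarrow_regeom₄ (Subgroup.pow_mem _ (cobVec_mem_cob _ _) k) (D₀.regeom₄.decompAt_le v σ.2), σ.2⟩)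
    (fun x hx => by
      rw [localDataStandIn_H] at hx
      exact hx.2)
    hχ D₀.suppCard_cobVec_labelCode_injective

/-- **EVALSECT-NV OF RECORD (∃-headline, relative to `hA` and `χ_v`)**: at `regeom₄` the binder of (C″)/(K‴) is inhabited at every index `v` carrying a
nontrivial `ℤ/l`-character of its decomposition group. ([IUTchI] Ex 4.4 (i) p.106) [claim: Mochizuki2012, status: disputed] -/
theorem nonempty_evalSectionBinder_localDataStandIn_regeom₄ (v : D₀.regeom₄.IndexCopy)
    (χ : ↥(D₀.regeom₄.decompAt v) →* Multiplicative (ZMod l)) (hχ : χ ≠ 1) :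
    Nonempty (EvalSectionBinder
      (D₀.regeom₄.localDataStandIn D₀.cuspGaloisRegeom₄ D₀.cuspClassesNormaliserStable_regeom₄
        D₀.unramifiedTorsionMonodromyRegeom₄.toTorsionMonodromy hA₄ (D₀.unramifiedTorsionMonodromyRegeom₄.tau_inertia _) v)
      (D₀.regeom₄.decompAt v)) :=
  ⟨D₀.evalSectionBinder_localDataStandIn_regeom₄ hA₄ v χ hχ⟩

/-- **EVALSECT-NV at `regeom₄` over `Gv := G_K`, BINDER-FREE but for `hA`** (stage C C3): with the cyclotomic character of `G_K` (p465974) the TYPE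
`EvalSectionBinder δ G_K` is inhabited at the good-place local datum `δ := LocalDatum.ofGood G_K …` of `regeom₄` (a sibling of the stand-in datum with
the same local group over `G_K`; NV of the binder TYPE — it does not feed (C″), which lives over `decompAt v`). ([IUTchI] Ex 4.4 (i) p.106) [claim: Mochizuki2012, status: disputed] -/
theorem nonempty_evalSectionBinder_regeom₄ (hA₄ : D₀.regeom₄.geom.pe.ArrowCoveringClaims) :
    ∃ δ : D₀.regeom₄.LocalDatum D₀.cuspGaloisRegeom₄ D₀.cuspClassesNormaliserStable_regeom₄,
      δ.H = D₀.regeom₄.PiXarrow ⊓ (galoisSubgroupOf F K Fbar).comap D₀.regeom₄.augGF ∧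
        Nonempty (EvalSectionBinder δ (galoisSubgroupOf F K Fbar)) := by
  obtain ⟨χ, hχ⟩ := D₀.exists_character_galoisSubgroupOf_ne_one
  refine ⟨LocalDatum.ofGood (galoisSubgroupOf F K Fbar)
      (InitialThetaData.localArrowLaw_local_of_torsionMonodromy D₀.cuspGaloisRegeom₄ D₀.cuspClassesNormaliserStable_regeom₄
        D₀.unramifiedTorsionMonodromyRegeom₄.toTorsionMonodromy hA₄ (D₀.unramifiedTorsionMonodromyRegeom₄.tau_inertia _) _) hA₄,
    rfl, nonempty_evalSectionBinder_of_character _ (MulEquiv.refl _) D₀.augGF_regeom₄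
      (fun σ hσ => D₀.fixesTorsion_of_mem_galoisSubgroupOf σ hσ) χ (fun j => cobVec D₀.lineGen (labelCode j))
      (fun _ k σ => ⟨D₀.uElt_mem_PiXarrow_regeom₄ (Subgroup.pow_mem _ (cobVec_mem_cob _ _) k) σ.2, σ.2⟩)
      (fun _ hx => hx.2) hχ D₀.suppCard_cobVec_labelCode_injective⟩

/-- **THE ES TERM OF RECORD, `hA` DISCHARGED** (abc-iut-L5-t8 stage C C3 `arrowCoveringClaimsRegeom₄`, p473323): MODULO ONLY a `ℤ/l`-character `χ_v ≠ 1`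
of the decomposition group. (Any other proof term of `ArrowCoveringClaims` in the datum — e.g. (C″)'s `arrowCoveringClaims_pe_of_modLCuspLaws CG hL` — gives
the SAME type by proof irrelevance.) ([IUTchI] Ex 4.4 (i) p.106) [claim: Mochizuki2012, status: disputed] -/
def evalSectionBinderRegeom₄ (v : D₀.regeom₄.IndexCopy) (χ : ↥(D₀.regeom₄.decompAt v) →* Multiplicative (ZMod l))
    (hχ : χ ≠ 1) :
    EvalSectionBinder
      (D₀.regeom₄.localDataStandIn D₀.cuspGaloisRegeom₄ D₀.cuspClassesNormaliserStable_regeom₄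
        D₀.unramifiedTorsionMonodromyRegeom₄.toTorsionMonodromy D₀.arrowCoveringClaimsRegeom₄
        (D₀.unramifiedTorsionMonodromyRegeom₄.tau_inertia _) v)
      (D₀.regeom₄.decompAt v) :=
  D₀.evalSectionBinder_localDataStandIn_regeom₄ D₀.arrowCoveringClaimsRegeom₄ v χ hχ

/-- **EVALSECT-NV OF RECORD (headline)**: at the single-point datum `regeom₄` — where ALL of `{CG, M′, hL, hA, hS}` are TERMS (stage C) — the
evaluation-section binder of (C″)/(K‴) at the bad index `v` is INHABITED as soon as the decomposition group `decompAt v` carries a nontrivial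
`ℤ/l`-character. ([IUTchI] Ex 4.4 (i) p.106) [claim: Mochizuki2012, status: disputed] -/
theorem nonempty_evalSectionBinderRegeom₄ (v : D₀.regeom₄.IndexCopy) (χ : ↥(D₀.regeom₄.decompAt v) →* Multiplicative (ZMod l))
    (hχ : χ ≠ 1) :
    Nonempty (EvalSectionBinder
      (D₀.regeom₄.localDataStandIn D₀.cuspGaloisRegeom₄ D₀.cuspClassesNormaliserStable_regeom₄
        D₀.unramifiedTorsionMonodromyRegeom₄.toTorsionMonodromy D₀.arrowCoveringClaimsRegeom₄
        (D₀.unramifiedTorsionMonodromyRegeom₄.tau_inertia _) v)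
      (D₀.regeom₄.decompAt v)) :=
  ⟨D₀.evalSectionBinderRegeom₄ v χ hχ⟩

/-- **EVALSECT-NV over `G_K` at `regeom₄` — BINDER-FREE**: the TYPE `EvalSectionBinder δ G_K` is inhabited at the good-place local datum of `regeom₄` over
`G_K` (CG, hS, M′, hA all TERMS; `χ` the cyclotomic character of p465974). ([IUTchI] Ex 4.4 (i) p.106) [claim: Mochizuki2012, status: disputed] -/
theorem nonempty_evalSectionBinder_regeom₄_GK :
    ∃ δ : D₀.regeom₄.LocalDatum D₀.cuspGaloisRegeom₄ D₀.cuspClassesNormaliserStable_regeom₄,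
      δ.H = D₀.regeom₄.PiXarrow ⊓ (galoisSubgroupOf F K Fbar).comap D₀.regeom₄.augGF ∧
        Nonempty (EvalSectionBinder δ (galoisSubgroupOf F K Fbar)) :=
  D₀.nonempty_evalSectionBinder_regeom₄ D₀.arrowCoveringClaimsRegeom₄

end InitialThetaData

end Regeom4

end Literature.IUT.HodgeTheaters

end
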